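import Mathlib
import Summits.ValiantsHypothesis.ValiantsHypothesis.Theorems.DivisionGapPerMultiplesHardStubRowConcentration
import Literature.Computability.AlgebraicComplexity.ArithCircuitProofs
import Literature.Computability.AlgebraicComplexity.PermanentIrreducible

/-!
# `DivisionGap.PerMultiplesHard` (stmt-ValiantsHypothesis-5068), line `uncharged-face-walk`:
the line-projection rung, column form (stub `stub_colConcentration`)

Let `h ≠ 0` be a multiplier over `ℝ≥0` all of whose exponents have total degree `D`, and suppose
some exponent `d₀` of `h` has the `m + 1` ROWS `A` concentrated in COLUMN `j` (every cell of `d₀`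
in a row of `A` lies in column `j`).  Then `m (2^{m-1} - 1) ≤ 2 · L⁺(per_n · h) + 2` for the
tree's monotone fan-in-two `complexity` over `ℝ≥0`.

Proof: TRANSPOSE.  Renaming along the involution `Prod.swap` of the variable set `Fin n × Fin n`
fixes the generic permanent (`per(Xᵀ) = per(X)`, `Matrix.permanent_transpose`), preserves
`complexity` (`complexity_rename_of_injective_holds`), preserves nonvanishing, total degrees of
exponents (`Finsupp.degree_mapDomain`) and turns "rows `A` concentrated in column `j`" into
"columns `A` concentrated in row `j`".  The row form `RowConcentration.stub_rowConcentration`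
(landed) then applies to `hᵀ = rename Prod.swap h`, and
`per_n · hᵀ = rename Prod.swap (per_n · h)` has the complexity of `per_n · h`. [folklore]
-/

noncomputable section

open MvPolynomial Literature.Computability.AlgebraicComplexity
open scoped NNReal BigOperators
open Summit.ValiantsHypothesis.ValiantsHypothesis.Theorems.DivisionGap.PerMultiplesHard.RowConcentration
  (stub_rowConcentration)

namespace Summit.ValiantsHypothesis.ValiantsHypothesis.Theorems.DivisionGap.PerMultiplesHard.ColConcentration

variable {n : ℕ}

/-- The generic permanent over `ℝ≥0` is symmetric: `per(Xᵀ) = per(X)`, i.e. renaming the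
variables along `Prod.swap` fixes `per_n`. [folklore] -/
theorem rename_swap_perPoly :
    rename (Prod.swap : Fin n × Fin n → Fin n × Fin n) (perPoly (Fin n) ℝ≥0) =
      perPoly (Fin n) ℝ≥0 := by
  -- adapted from ValuativeGCTValuativeFlipTangentRank.lean (`tr_rename_swap_perPoly`)
  have h : rename (Prod.swap : Fin n × Fin n → Fin n × Fin n) (perPoly (Fin n) ℝ≥0) =
      ((Matrix.mvPolynomialX (Fin n) (Fin n) ℝ≥0).transpose).permanent := by
    simp [perPoly, Matrix.permanent, map_sum, map_prod, Matrix.mvPolynomialX, rename_X]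
  rw [h, Matrix.permanent_transpose]
  rfl

/-- Transposing the variables does not change the monotone complexity of a permanental
multiple: `L⁺(per_n · hᵀ) = L⁺(per_n · h)`. [folklore] -/
theorem complexity_perPoly_mul_rename_swap (h : MvPolynomial (Fin n × Fin n) ℝ≥0) :
    complexity (perPoly (Fin n) ℝ≥0 * rename Prod.swap h) =
      complexity (perPoly (Fin n) ℝ≥0 * h) := by
  have hmul : perPoly (Fin n) ℝ≥0 * rename Prod.swap h =
      rename Prod.swap (perPoly (Fin n) ℝ≥0 * h) := by
    rw [map_mul, rename_swap_perPoly]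
  rw [hmul]
  exact complexity_rename_of_injective_holds Prod.swap_injective _

/-! ### The stub -/

/-- **Line projection, column form** (stub `stub_colConcentration` of line `uncharged-face-walk`).
If `h ≠ 0` is homogeneous in total degree and some exponent of `h` has the `m + 1` rows `A`
concentrated in column `j`, then `m (2^{m-1} - 1) ≤ 2 · L⁺(per_n · h) + 2`: transpose the
variables (free, and fixing `per_n`) and apply the row form. [cite: JerrumSnir1982, §4.3] -/
theorem stub_colConcentration :
    ∀ (n : ℕ) (h : MvPolynomial (Fin n × Fin n) ℝ≥0), h ≠ 0 →
      ∀ (D : ℕ), (∀ d ∈ h.support, d.degree = D) →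
      ∀ (j : Fin n) (A : Finset (Fin n)) (m : ℕ),
        (∃ d₀ ∈ h.support, ∀ e ∈ d₀.support, e.1 ∈ A → e.2 = j) →
        A.card = m + 1 → 1 ≤ m →
        m * (2 ^ (m - 1) - 1) ≤ 2 * complexity (perPoly (Fin n) ℝ≥0 * h) + 2 := by
  intro n h hh D hdeg j A m hconc hA hm
  classical
  obtain ⟨d₀, hd₀, hd₀c⟩ := hconc
  have hT : Function.Injective (Prod.swap : Fin n × Fin n → Fin n × Fin n) := Prod.swap_injective
  -- the transposed multiplier and its hypotheses
  have hg0 : rename Prod.swap h ≠ 0 := fun h0 =>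
    hh (rename_injective _ hT (by rw [h0, map_zero]))
  have hgdeg : ∀ d ∈ (rename Prod.swap h).support, d.degree = D := by
    intro d hd
    rw [support_rename_of_injective hT, Finset.mem_image] at hd
    obtain ⟨d', hd', rfl⟩ := hd
    rw [Finsupp.degree_mapDomain]
    exact hdeg d' hd'
  have hgconc : ∃ d₁ ∈ (rename Prod.swap h).support, ∀ e ∈ d₁.support, e.2 ∈ A → e.1 = j := by
    refine ⟨Finsupp.mapDomain Prod.swap d₀, ?_, fun e he heA => ?_⟩
    · rw [support_rename_of_injective hT]
      exact Finset.mem_image_of_mem _ hd₀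
    · rw [Finsupp.mapDomain_support_of_injective hT, Finset.mem_image] at he
      obtain ⟨e', he', rfl⟩ := he
      exact hd₀c e' he' heA
  have key := stub_rowConcentration n (rename Prod.swap h) hg0 D hgdeg j A m hgconc hA hm
  rwa [complexity_perPoly_mul_rename_swap] at key

end Summit.ValiantsHypothesis.ValiantsHypothesis.Theorems.DivisionGap.PerMultiplesHard.ColConcentration

end
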